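import Summits.BirchSwinnertonDyer.BirchSwinnertonDyer.Theorems.KolyvaginDepthDoorDepthTableRowKitNoTwistTwistSelmer
import Summits.BirchSwinnertonDyer.BirchSwinnertonDyer.Theorems.KolyvaginDepthDoorKolyvaginDepthSupplyDoorOfDatumDepth
import HarnessLib

/-!
# Route `KolyvaginDepthDoor` — the DEPTH-TWO (rank-3) ROW KIT OF A DATUM: no structure theorem, no twist
# point, NO SYSTEM (crux `KolyvaginDepthSupply`, stmt-BirchSwinnertonDyer-21765)

Helper file (`--supports stmt-BirchSwinnertonDyer-21765 --as helper`); it closes nothing and BSD is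
not proved by it.

g6's depth-two kit `depthRowTwo_noTwist_of_print_of_intModel_certificate` (file
`…DepthTableRowKitNoTwistDepthTwo`) needs a COMPATIBLE SYSTEM `d : ∀ m : ℕ, KolyvaginHeegnerData Dt β ι m`
(four coherence binders over all `(m, l)`; not known to be inhabited at `m = 0`). This file drops it: the
bit is read at ANY datum `d : KolyvaginHeegnerData Dt β ι (ℓ₁ℓ₂)`, the compatible system through `d`
being a theorem (`exists_kolyvaginHeegnerSystem_extending`, file `…KolyvaginHeegnerSystem`; doors
`shaCorank_eq_zero_of_kolyvaginClass_ne_zero_of_rank_le_of_datum`,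
`natCard_selmerGroup_twist_le_of_kolyvaginClass_ne_zero_of_datum`).

* `depthRowTwo_noTwist_of_datum_of_intModel_certificate` — inputs: the integer-model certificate of a
  depth-2 row (two Kolyvagin primes `ℓ₁ ≠ ℓ₂`, `3 ≤ rank_ℤ E(ℚ)`), the five named McCallum/Gross facts,
  ONE datum `d` of conductor `ℓ₁ℓ₂` and its bit `d.kolyvaginClass hp 1 ≠ 0`; OUTPUT:
  `corank_{ℤ_p} Ш(E/ℚ)[p^∞] = 0`, `rank_ℤ E(ℚ) = 3`, `rank_ℤ E^{(D)}(ℚ) ≤ 2`, `E(ℚ)[p] = 0`,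
  `Ш(E/ℚ)[p] = 0`, `#Sel^(p)(E/ℚ) = p³`, `#Sel^(p)(E^{(D)}/ℚ) ≤ p²`.

CONDITIONAL on the five named facts and the bit; per-curve; BSD is not proved by it.

References: [Kolyvagin1991MathAnn] Thm. 2.3; [GrossLMS1991] §§3–5, §10; [McCallumLMS1991] §§2–5;
[WZhang2014] Notations (xii).
-/

set_option linter.dupNamespace false

noncomputable section

open scoped Classical NumberField

namespace Summit.BirchSwinnertonDyer.BirchSwinnertonDyer.Theorems.KolyvaginDepthDoor

open Literature.NumberTheory.EllipticCurves Literature.NumberTheory.EllipticCurves.ModularForms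
  Literature.NumberTheory.EllipticCurves.McCallum1991 WeierstrassCurve NumberField IsDedekindDomain

section Generic

variable {W : WeierstrassCurve ℚ} [W.IsElliptic] [W.IsGloballyMinimal] {E₀ : WeierstrassCurve ℤ}
  (hI : integralModelInt W = E₀)
include hI

/-- **The DEPTH-TWO row (rank 3) off an integer model — OF A DATUM (no `hF`, no twist point, no
system).** Inputs: globally minimal non-CM `W/ℚ` with integral model `E₀`, `3 ≤ rank_ℤ E(ℚ)`, `p` odd
with `ρ̄_{E,p^n}` onto for all `n`, an imaginary quadratic `K` with `d_K = D ∉ {−3, −4}` in which every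
prime of `Δ(E₀)` splits, two distinct odd primes `ℓᵢ ∤ Δ(E₀) D`, `ℓᵢ ≠ p`, `(D/ℓᵢ) = −1`,
`p ∣ ℓᵢ + 1`, `p ∣ ℓᵢ + 1 − #(E₀ mod ℓᵢ)(𝔽_ℓᵢ)`, the five named McCallum facts, a frame `(Dt, β, ι)`
and ONE datum `d : KolyvaginHeegnerData Dt β ι (ℓ₁ℓ₂)`. OUTPUT from the bit `d.kolyvaginClass hp 1 ≠ 0`:
`corank_{ℤ_p} Ш(E/ℚ)[p^∞] = 0`, `rank_ℤ E(ℚ) = 3`, `rank_ℤ E^{(D)}(ℚ) ≤ 2`, `E(ℚ)[p] = 0`,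
`Ш(E/ℚ)[p] = 0`, `#Sel^(p)(E/ℚ) = p³`, `#Sel^(p)(E^{(D)}/ℚ) ≤ p²`. CONDITIONAL on the five facts;
per-curve; BSD is not proved by it. [cite: Kolyvagin1991MathAnn, Thm. 2.3] [cite: McCallumLMS1991, §§2–5]
[cite: GrossLMS1991, §5 (5.1)] [cite: WZhang2014, Notations (xii)] -/
theorem depthRowTwo_noTwist_of_datum_of_intModel_certificate
    (h54 : sign_conjAct_kolyvaginClass) (h43 : lemma43_kolyvaginClass_mem_selmerLocalKer)
    (h44 : prop44_localOrder_kolyvaginClass_mul_eq) (h53 : lemma53_selmer_eigen_dependent_at)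
    (h22 : prop22_reciprocity_eigen_finset)
    (hcm : ¬ W.HasCM) (hr : 3 ≤ W.mordellWeilRank)
    (p : ℕ) [hp : Fact p.Prime] (hp2 : p ≠ 2)
    (htower : ∀ n : ℕ, W.HasSurjectiveModNGaloisRep (p ^ n : ℕ))
    (K : Type) [Field K] [NumberField K] (hK : IsImaginaryQuadratic K) {D : ℤ}
    (hD : NumberField.discr K = D) (h3 : D ≠ -3) (h4 : D ≠ -4)
    (hH : ∀ q : ℕ, q.Prime → (q : ℤ) ∣ E₀.Δ → (q = 2 → D % 8 = 1) ∧ (q ≠ 2 → jacobiSym D q = 1))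
    (ℓ₁ : ℕ) (hℓ₁ : ℓ₁.Prime) (hℓ₁2 : ℓ₁ ≠ 2) (hℓ₁Δ : ¬ (ℓ₁ : ℤ) ∣ E₀.Δ) (hℓ₁D : ¬ (ℓ₁ : ℤ) ∣ D)
    (hℓ₁p : ℓ₁ ≠ p) (hjac₁ : jacobiSym D ℓ₁ = -1) (hℓ₁1 : p ∣ ℓ₁ + 1) {n₁ : ℕ}
    (hcard₁ : Nat.card ((E₀.map (Int.castRingHom (ZMod ℓ₁))).toAffine.Point) = n₁)
    (haℓ₁ : (p : ℤ) ∣ (ℓ₁ : ℤ) + 1 - n₁)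
    (ℓ₂ : ℕ) (hℓ₂ : ℓ₂.Prime) (hℓ₂2 : ℓ₂ ≠ 2) (hℓ₂Δ : ¬ (ℓ₂ : ℤ) ∣ E₀.Δ) (hℓ₂D : ¬ (ℓ₂ : ℤ) ∣ D)
    (hℓ₂p : ℓ₂ ≠ p) (hjac₂ : jacobiSym D ℓ₂ = -1) (hℓ₂1 : p ∣ ℓ₂ + 1) {n₂ : ℕ}
    (hcard₂ : Nat.card ((E₀.map (Int.castRingHom (ZMod ℓ₂))).toAffine.Point) = n₂)
    (haℓ₂ : (p : ℤ) ∣ (ℓ₂ : ℤ) + 1 - n₂) (hℓℓ : ℓ₁ ≠ ℓ₂)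
    [NeZero (W.conductorNorm ℤ)] (Dt : ModularParametrizationData W (W.conductorNorm ℤ)) (β : ℤ)
    (ι : K →+* ℂ) (d : KolyvaginHeegnerData Dt β ι (ℓ₁ * ℓ₂))
    (hne : d.kolyvaginClass hp.out 1 ≠ 0) :
    W.shaCorank p = 0 ∧ W.mordellWeilRank = 3 ∧ (W.quadraticTwist (D : ℚ)).mordellWeilRank ≤ 2 ∧
      (∀ P : W.toAffine.Point, p • P = 0 → P = 0) ∧ (∀ c ∈ W.sha, p • c = 0 → c = 0) ∧
      Nat.card ↥(selmerGroup W (p : ℤ)) = p ^ 3 ∧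
      Nat.card ↥(selmerGroup (W.quadraticTwist (D : ℚ)) (p : ℤ)) ≤ p ^ 2 := by
  obtain ⟨hkol₁, -⟩ := isKolyvaginPrime_of_intModel_certificate hI p K hK.1 hD ℓ₁ hℓ₁ hℓ₁2 hℓ₁Δ hℓ₁D
    hℓ₁p hjac₁ hℓ₁1 hcard₁ haℓ₁
  obtain ⟨hkol₂, -⟩ := isKolyvaginPrime_of_intModel_certificate hI p K hK.1 hD ℓ₂ hℓ₂ hℓ₂2 hℓ₂Δ hℓ₂D
    hℓ₂p hjac₂ hℓ₂1 hcard₂ haℓ₂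
  obtain ⟨c, hc, hcc⟩ := exists_conj_of_isImaginaryQuadratic K hK
  have hH' := satisfiesHeegnerHypothesis_conductorNorm_of_intModel hI K hK.1 hD hH
  -- `n = ℓ₁ℓ₂` is a square-free product of two Kolyvagin primes
  have hcop : ℓ₁.Coprime ℓ₂ := (Nat.coprime_primes hℓ₁ hℓ₂).mpr hℓℓ
  have hsq : Squarefree (ℓ₁ * ℓ₂) :=
    Nat.squarefree_mul_iff.mpr ⟨hcop, hℓ₁.squarefree, hℓ₂.squarefree⟩
  have hpf : (ℓ₁ * ℓ₂).primeFactors = {ℓ₁, ℓ₂} := by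
    rw [Nat.Coprime.primeFactors_mul hcop, hℓ₁.primeFactors, hℓ₂.primeFactors]
    rfl
  have hcard : (ℓ₁ * ℓ₂).primeFactors.card = 2 := by
    rw [hpf, Finset.card_insert_of_notMem (by rw [Finset.mem_singleton]; exact hℓℓ),
      Finset.card_singleton]
  have hk : ∀ q ∈ (ℓ₁ * ℓ₂).primeFactors, Zhang2014.IsKolyvaginPrime (W.conductorNorm ℤ) W K p q := by
    intro q hq
    rw [hpf, Finset.mem_insert, Finset.mem_singleton] at hq
    rcases hq with rfl | rfl
    · exact hkol₁
    · exact hkol₂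
  obtain ⟨hsha, hrk, hr', ht, hbot, hSel⟩ :=
    shaCorank_eq_zero_of_kolyvaginClass_ne_zero_of_rank_le_of_datum h54 h43 h44 h53 h22 hcm hK
      (by rw [hD]; exact h3) (by rw [hD]; exact h4) hH' p hp2 htower c hc hcc hsq hk d hne
      (by rw [hcard]; exact hr)
  obtain ⟨-, hSelT, -⟩ :=
    natCard_selmerGroup_twist_le_of_kolyvaginClass_ne_zero_of_datum h54 h43 h44 h53 h22 hcm hK
      (by rw [hD]; exact h3) (by rw [hD]; exact h4) hH' p hp2 htower c hc hcc hsq hk d hne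
      (by rw [hcard]; exact hr)
  rw [hcard] at hrk hr' hSel hSelT
  rw [pow_one] at ht hbot hSel hSelT
  rw [hD] at hr' hSelT
  refine ⟨hsha, hrk, hr', fun P hP ↦ ?_, fun x hx hpx ↦ ?_, hSel, hSelT⟩
  · have hmem : P ∈ AddSubgroup.torsionBy W.toAffine.Point (p : ℤ) :=
      AddSubgroup.torsionBy.nsmul_iff.mpr hP
    rw [AddSubgroup.card_eq_one.mp ht] at hmem
    exact (AddSubgroup.mem_bot).mp hmem
  · have hmem : x ∈ W.sha ⊓ AddSubgroup.torsionBy W.galH1 (p : ℤ) :=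
      AddSubgroup.mem_inf.mpr ⟨hx, AddSubgroup.torsionBy.nsmul_iff.mpr hpx⟩
    rw [hbot] at hmem
    exact (AddSubgroup.mem_bot).mp hmem

end Generic

end Summit.BirchSwinnertonDyer.BirchSwinnertonDyer.Theorems.KolyvaginDepthDoor

end
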